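import Mathlib
import HarnessLib

/-!
# Connectivity correlation inequalities for `φ_{w,q}` — file (DEFINITION): the TYPE-WORD MODEL of the four-terminal cross
# functional `X2` and the matching rule ("nearest balanced window + soliton shift")

Definitions file (`--supports stmt-CriticalPhenomena-4575`), FK sub-lane `prim-bschramm-fk-2` (gen 13) of the post-continuity
programme; builds on p205010 (kernel theorem, internal audit signed; external expert review pending).  Pure finite combinatorics:
no measure theory, no graphs, no named facts, no sorries.

CONTEXT (memos `bschramm/FROM-fk-2-g12-SPLIT-UPC.md` §4 and `bschramm/FROM-fk-2-g13-WORD-HALL.md`, FK-Q2.md §21–22).  The conjecture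
node `FK.ApX2Pos` of `…AntipodalSplitDefs` (`apX2 ≥ 0` on two-terminal series–parallel networks, every `q > 0`) reduces, along the
spine of the marked edge, to a Hall-type matching problem on words ("WORD-HALL"), and that problem reduces to the following TYPE-WORD
MODEL.  A type word is a list `x : List Ty` over `Ty = {E, M, F}` ("ground / mixed / flipped") whose positions ("blocks") carry
alternating kinds `W, P, W, P, …` starting from `k₀`.  Row `A` SEES a `W`-block unless it is `F` and a `P`-block unless it is `E`;
row `B` sees a `W`-block unless it is `E` and a `P`-block unless it is `F`; the row words `rowA`, `rowB` list the kinds of the visible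
blocks.  A word is a LOSER if `rowA` does not start with `P`, `rowB` ends with `P`, and not (`rowA` ends with `P` and `rowB` does not
start with `P`); a WINNER symmetrically; its LEVEL is `R = #(maximal P-runs of rowA) + #(maximal P-runs of rowB)`.  The global swap
`E ↔ F` exchanges the rows, hence losers and winners.  WORD-HALL asks for an injection loser ↦ winner raising only ground blocks
outside a window and preserving `R`; by the symmetry it is equivalent to an INVOLUTION `ι` on losers, `ι x =` "swap `E ↔ F` inside a
window `W(x)` containing every non-ground block", with `ι x` a loser, `R (ι x) = R x`, `W (ι x) = W x` (memo g13 §1).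
THIS FILE defines the model and the explicit rule `ruleN` (memo g13 §2): for a generic loser with hull `[h, h']` the window is
`[s*, t*]`, `s* = h` if the first `A`-visible and the first `B`-visible block from `h` on have the same kind ("balanced"), else `h - 1`;
`t*` symmetrically; the SOLITON words (only `W`-blocks, or only `P`-blocks, flipped, at consecutive positions of that kind) and the
ground word are paired by an explicit one-block shift.  The theorem that `ruleN` is a valid involution for every length (memo g13
Theorem A; machine-checked for all words with `≤ 14` blocks) is the object of the sibling files; here only definitions, the basic
symmetries (`rowA_map_swap`, `isLoser_map_swap`) and small sanity instances are recorded.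
Literature status: negative dependence of `φ_{q<1}` beyond pairwise statements is open in print (Grimmett 2006 §3.9; for wired
trees see Park 2026, arXiv:2608.08565, Thm 6.4); nothing of the present combinatorial kind was found.
[cite: Grimmett2006, §3.9 (p. 63)]
-/

namespace Summit.CriticalPhenomena.PercolationContinuityZ3.Theorems

namespace FK

namespace X2Word

/-! ### Kinds, types, visibility -/

/-- Kind of a block of the spine: `W` = a series position ("wall"), `P` = a parallel position ("particle"). [folklore] -/
inductive Kind | W | P
  deriving DecidableEq, Repr, Inhabited

/-- The other kind (`W ↔ P`); kinds alternate along a type word. [folklore] -/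
def Kind.other : Kind → Kind
  | .W => .P
  | .P => .W

/-- `W.other = P`. [folklore] -/
@[simp] theorem Kind.other_W : Kind.W.other = .P := rfl
/-- `P.other = W`. [folklore] -/
@[simp] theorem Kind.other_P : Kind.P.other = .W := rfl
/-- `other` is an involution. [folklore] -/
@[simp] theorem Kind.other_other (k : Kind) : k.other.other = k := by cases k <;> rfl

/-- The kind of block `i` when block `0` has kind `k₀` (alternation). [folklore] -/
def kindAt (k₀ : Kind) (i : ℕ) : Kind := Kind.other^[i] k₀

/-- Block `0` has kind `k₀`. [folklore] -/
@[simp] theorem kindAt_zero (k₀ : Kind) : kindAt k₀ 0 = k₀ := rfl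
/-- Kinds alternate. [folklore] -/
theorem kindAt_succ (k₀ : Kind) (i : ℕ) : kindAt k₀ (i + 1) = (kindAt k₀ i).other := by
  simp [kindAt, Function.iterate_succ_apply']

/-- Type of a block: `E` = ground (no flipped letter), `M` = mixed (or containing a frozen letter), `F` = fully flipped. [folklore] -/
inductive Ty | E | M | F
  deriving DecidableEq, Repr, Inhabited

/-- The in-window row swap on types: `E ↔ F`, `M ↦ M`. [folklore] -/
def Ty.swap : Ty → Ty
  | .E => .F
  | .M => .M
  | .F => .E

/-- `E.swap = F`. [folklore] -/
@[simp] theorem Ty.swap_E : Ty.E.swap = .F := rfl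
/-- `M.swap = M`. [folklore] -/
@[simp] theorem Ty.swap_M : Ty.M.swap = .M := rfl
/-- `F.swap = E`. [folklore] -/
@[simp] theorem Ty.swap_F : Ty.F.swap = .E := rfl
/-- `swap` is an involution. [folklore] -/
@[simp] theorem Ty.swap_swap (e : Ty) : e.swap.swap = e := by cases e <;> rfl

/-- Row `A` (the `ω`-side) sees a `W`-block unless it is fully flipped and a `P`-block unless it is ground. [folklore] -/
def visA : Kind → Ty → Bool
  | .W, e => decide (e ≠ .F)
  | .P, e => decide (e ≠ .E)

/-- Row `B` (the complementary side) sees a `W`-block unless it is ground and a `P`-block unless it is fully flipped. [folklore] -/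
def visB : Kind → Ty → Bool
  | .W, e => decide (e ≠ .E)
  | .P, e => decide (e ≠ .F)

/-- Swapping a block exchanges its visibility to the two rows. [folklore] -/
@[simp] theorem visA_swap (k : Kind) (e : Ty) : visA k e.swap = visB k e := by cases k <;> cases e <;> rfl
/-- Swapping a block exchanges its visibility to the two rows. [folklore] -/
@[simp] theorem visB_swap (k : Kind) (e : Ty) : visB k e.swap = visA k e := by cases k <;> cases e <;> rfl

/-! ### Row words, first/last letters, runs, losers and winners -/

/-- Row `A` of a type word read from a block of kind `k`: the kinds of the `A`-visible blocks, in order. [folklore] -/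
def rowA : Kind → List Ty → List Kind
  | _, [] => []
  | k, e :: x => (if visA k e then [k] else []) ++ rowA k.other x

/-- Row `B` of a type word read from a block of kind `k`: the kinds of the `B`-visible blocks, in order. [folklore] -/
def rowB : Kind → List Ty → List Kind
  | _, [] => []
  | k, e :: x => (if visB k e then [k] else []) ++ rowB k.other x

/-- Row `A` of the empty word. [folklore] -/
@[simp] theorem rowA_nil (k : Kind) : rowA k [] = [] := rfl
/-- Row `B` of the empty word. [folklore] -/
@[simp] theorem rowB_nil (k : Kind) : rowB k [] = [] := rfl
/-- Row `A`, one block at a time. [folklore] -/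
theorem rowA_cons (k : Kind) (e : Ty) (x : List Ty) :
    rowA k (e :: x) = (if visA k e then [k] else []) ++ rowA k.other x := rfl
/-- Row `B`, one block at a time. [folklore] -/
theorem rowB_cons (k : Kind) (e : Ty) (x : List Ty) :
    rowB k (e :: x) = (if visB k e then [k] else []) ++ rowB k.other x := rfl

/-- Swapping every block exchanges the two rows. [folklore] -/
theorem rowA_map_swap (k : Kind) (x : List Ty) : rowA k (x.map Ty.swap) = rowB k x := by
  induction x generalizing k with
  | nil => rfl
  | cons e x ih => simp [rowA_cons, rowB_cons, ih]

/-- Swapping every block exchanges the two rows. [folklore] -/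
theorem rowB_map_swap (k : Kind) (x : List Ty) : rowB k (x.map Ty.swap) = rowA k x := by
  induction x generalizing k with
  | nil => rfl
  | cons e x ih => simp [rowA_cons, rowB_cons, ih]

/-- Row `A` of a concatenation (the second part is read from the kind `kindAt k |x|`). [folklore] -/
theorem rowA_append (k : Kind) (x y : List Ty) : rowA k (x ++ y) = rowA k x ++ rowA (kindAt k x.length) y := by
  induction x generalizing k with
  | nil => simp
  | cons e x ih =>
    simp only [List.cons_append, rowA_cons, ih, List.append_assoc, List.length_cons]
    simp [kindAt, Function.iterate_succ_apply]

/-- Row `B` of a concatenation. [folklore] -/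
theorem rowB_append (k : Kind) (x y : List Ty) : rowB k (x ++ y) = rowB k x ++ rowB (kindAt k x.length) y := by
  induction x generalizing k with
  | nil => simp
  | cons e x ih =>
    simp only [List.cons_append, rowB_cons, ih, List.append_assoc, List.length_cons]
    simp [kindAt, Function.iterate_succ_apply]

/-- `headP l` : the row word `l` starts with a particle. [folklore] -/
def headP (l : List Kind) : Bool := decide (l.head? = some .P)

/-- `lastP l` : the row word `l` ends with a particle. [folklore] -/
def lastP (l : List Kind) : Bool := decide (l.getLast? = some .P)

/-- Number of maximal runs of `P` in a row word, given whether the letter before it was a `P`. [folklore] -/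
def runsAux : Bool → List Kind → ℕ
  | _, [] => 0
  | b, .P :: l => (if b then 0 else 1) + runsAux true l
  | _, .W :: l => runsAux false l

/-- Number of maximal runs of particles in a row word. [folklore] -/
def runsP (l : List Kind) : ℕ := runsAux false l

/-- The LEVEL `level = R = #P-runs(row A) + #P-runs(row B)` of a type word (the antipodal cluster exponent up to an additive constant and the
internal levels of the blocks, memo g12 §4.2). [folklore] -/
def level (k₀ : Kind) (x : List Ty) : ℕ := runsP (rowA k₀ x) + runsP (rowB k₀ x)

/-- LOSER type word (Boolean test): row `A` does not start with `P`, row `B` ends with `P`, and not (row `A` ends with `P` while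
row `B` does not start with `P`) — the sign `-1` of the cross functional `X2` (memo g12 §4.2). [folklore] -/
def isLoser (k₀ : Kind) (x : List Ty) : Bool :=
  !headP (rowA k₀ x) && lastP (rowB k₀ x) && !(lastP (rowA k₀ x) && !headP (rowB k₀ x))

/-- WINNER type word (Boolean test): the loser test with the two rows exchanged — the sign `+1` of `X2`. [folklore] -/
def isWinner (k₀ : Kind) (x : List Ty) : Bool :=
  lastP (rowA k₀ x) && !headP (rowB k₀ x) && !(lastP (rowB k₀ x) && !headP (rowA k₀ x))

/-- The global swap turns losers into winners … [folklore] -/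
theorem isWinner_map_swap (k₀ : Kind) (x : List Ty) : isWinner k₀ (x.map Ty.swap) = isLoser k₀ x := by
  simp only [isWinner, isLoser, rowA_map_swap, rowB_map_swap]
  cases headP (rowA k₀ x) <;> cases lastP (rowA k₀ x) <;> cases headP (rowB k₀ x) <;> cases lastP (rowB k₀ x) <;> rfl

/-- … and winners into losers, … [folklore] -/
theorem isLoser_map_swap (k₀ : Kind) (x : List Ty) : isLoser k₀ (x.map Ty.swap) = isWinner k₀ x := by
  simp only [isWinner, isLoser, rowA_map_swap, rowB_map_swap]
  cases headP (rowA k₀ x) <;> cases lastP (rowA k₀ x) <;> cases headP (rowB k₀ x) <;> cases lastP (rowB k₀ x) <;> rfl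

/-- … preserving the level. [folklore] -/
theorem level_map_swap (k₀ : Kind) (x : List Ty) : level k₀ (x.map Ty.swap) = level k₀ x := by
  simp [level, rowA_map_swap, rowB_map_swap, Nat.add_comm]

/-! ### Windows, hull, balance, solitons and the rule -/

/-- Swap `E ↔ F` on the blocks with index in the window `[s, t]` (inclusive). [folklore] -/
def swapWin (s t : ℕ) (x : List Ty) : List Ty := x.mapIdx fun i e => if s ≤ i ∧ i ≤ t then e.swap else e

/-- A window swap preserves the length. [folklore] -/
@[simp] theorem length_swapWin (s t : ℕ) (x : List Ty) : (swapWin s t x).length = x.length := by simp [swapWin]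

/-- A window swap is an involution. [folklore] -/
theorem swapWin_swapWin (s t : ℕ) (x : List Ty) : swapWin s t (swapWin s t x) = x := by
  apply List.ext_getElem (by simp)
  intro i h₁ h₂
  simp only [swapWin, List.getElem_mapIdx]
  split_ifs <;> simp

/-- Index of the first non-ground block (`none` for the ground word). [folklore] -/
def hullStart (x : List Ty) : Option ℕ := x.findIdx? (· ≠ .E)

/-- Index of the last non-ground block (`none` for the ground word). [folklore] -/
def hullEnd (x : List Ty) : Option ℕ := (x.reverse.findIdx? (· ≠ .E)).map fun j => x.length - 1 - j

/-- Kind of the first `A`-visible block at or after position `h` (`none` if there is none). [folklore] -/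
def firstA (k₀ : Kind) (x : List Ty) (h : ℕ) : Option Kind := (rowA (kindAt k₀ h) (x.drop h)).head?

/-- Kind of the first `B`-visible block at or after position `h`. [folklore] -/
def firstB (k₀ : Kind) (x : List Ty) (h : ℕ) : Option Kind := (rowB (kindAt k₀ h) (x.drop h)).head?

/-- Kind of the last `A`-visible block at or before position `h'`. [folklore] -/
def lastA (k₀ : Kind) (x : List Ty) (h' : ℕ) : Option Kind := (rowA k₀ (x.take (h' + 1))).getLast?

/-- Kind of the last `B`-visible block at or before position `h'`. [folklore] -/
def lastB (k₀ : Kind) (x : List Ty) (h' : ℕ) : Option Kind := (rowB k₀ (x.take (h' + 1))).getLast?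

/-- The left end at `h` is BALANCED: the first `A`-visible and the first `B`-visible block from `h` on are both particles or both not. [folklore] -/
def balancedL (k₀ : Kind) (x : List Ty) (h : ℕ) : Bool := (firstA k₀ x h == some .P) == (firstB k₀ x h == some .P)

/-- The right end at `h'` is BALANCED: the last `A`-visible and the last `B`-visible block up to `h'` are both particles or both not. [folklore] -/
def balancedR (k₀ : Kind) (x : List Ty) (h' : ℕ) : Bool := (lastA k₀ x h' == some .P) == (lastB k₀ x h' == some .P)

/-- The SOLITON pattern `Σ(h, m)` of length `n`: fully flipped exactly at the positions `h, h+2, …, h+2m`, ground elsewhere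
(memo g13 §2; its kind is the kind of block `h`). [folklore] -/
def solitonPattern (n h m : ℕ) : List Ty :=
  (List.range n).map fun i => if h ≤ i ∧ i ≤ h + 2 * m ∧ (i - h) % 2 = 0 then .F else .E

/-- `isSoliton k₀ x k h m` (Boolean test): `x` is the soliton word `Σ_k(h, m)` — the pattern `solitonPattern x.length h m` with
`h + 2m` inside the word and block `h` of kind `k`. [folklore] -/
def isSoliton (k₀ : Kind) (x : List Ty) (k : Kind) (h m : ℕ) : Bool :=
  decide (kindAt k₀ h = k) && decide (h + 2 * m < x.length) && decide (x = solitonPattern x.length h m)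

/-- The SOLITON SHIFT (memo g13 §2 (S)): the window of the soliton word `Σ_k(h,m)` — `Σ_W(h,m) ↦ [h, h+2m+1]` (`h ≥ 1`),
`Σ_W(0,m) ↦ [0, 2m]` (`m ≥ 1`), `Σ_W(0,0) ↦ [0,0]`; `Σ_P(h,m) ↦ [h-1, h+2m]` (`h ≥ 2`), `Σ_P(1,m) ↦ [0, 2m+2]`. [folklore] -/
def solitonWindow (k : Kind) (h m : ℕ) : ℕ × ℕ :=
  match k with
  | .W => if h = 0 then (if m = 0 then (0, 0) else (0, 2 * m)) else (h, h + 2 * m + 1)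
  | .P => if h ≤ 1 then (0, 2 * m + 2) else (h - 1, h + 2 * m)

/-- **RULE N** (memo g13 §2): the window `W(x) = some (s, t)` of a type word, or `none` for the fixed point (the ground word when
block `0` is a particle).  Ground word with `k₀ = W`: `[0,0]`.  Soliton words: `solitonWindow`.  Otherwise ("generic"): with hull
`[h, h']`, `s = h` if `balancedL` at `h` else `h - 1`, and `t = h'` if `balancedR` at `h'` else `h' + 1`.  (For a LOSER an unbalanced
left end has `h ≥ 1` and an unbalanced right end has `h' + 1 < |x|`, memo g13 Lemma 3.3, so the truncated subtraction and the
overflow never occur where the rule is used; on non-losers the value is of no interest.) [folklore] -/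
def ruleN (k₀ : Kind) (x : List Ty) : Option (ℕ × ℕ) :=
  match hullStart x, hullEnd x with
  | some h, some h' =>
    if isSoliton k₀ x (kindAt k₀ h) h ((h' - h) / 2) then
      some (solitonWindow (kindAt k₀ h) h ((h' - h) / 2))
    else
      some (if balancedL k₀ x h then h else h - 1, if balancedR k₀ x h' then h' else h' + 1)
  | _, _ => match k₀ with
    | .W => some (0, 0)
    | .P => none

/-- The partner `ι x` of a type word under RULE N: swap `E ↔ F` inside the window (identity at the fixed point). [folklore] -/
def iota (k₀ : Kind) (x : List Ty) : List Ty :=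
  match ruleN k₀ x with
  | some (s, t) => swapWin s t x
  | none => x

/-! ### Sanity instances (memo g13 §4 and the `EEFEEE ↔ EEEFEE` slide of g12 §4.5) -/

open Ty in
example : ruleN .W [E, E, F, E, E, E] = some (2, 3) := by decide
open Ty in
example : iota .W [E, E, F, E, E, E] = [E, E, E, F, E, E] := by decide
open Ty in
example : isLoser .W [E, E, F, E, E, E] ∧ isLoser .W [E, E, E, F, E, E] ∧ level .W [E, E, F, E, E, E] = level .W [E, E, E, F, E, E] := by
  decide
open Ty in
example : ruleN .W [E, E, F, F, E, E] = some (1, 4) ∧ iota .W [E, E, F, F, E, E] = [E, F, E, E, F, E] ∧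
    ruleN .W [E, F, E, E, F, E] = some (1, 4) := by decide
open Ty in
example : ruleN .W [E, E, E, E, E, E] = some (0, 0) ∧ ruleN .P [E, E, E, E] = none ∧ ruleN .W [F, E, F, E, E, E] = some (0, 2) := by
  decide

end X2Word

end FK

end Summit.CriticalPhenomena.PercolationContinuityZ3.Theorems
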